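import Literature.NumberTheory.Kottwitz1992.ModuliProblem
import Literature.RingTheory.CentralSimple.CentralizerCornerDimensions   -- ★ `isSquare_finrank_of_isCentral`: `[C:F]` is a square
import Literature.NumberTheory.NumberFields.PositiveInvolution            -- ★ Shimura §5.1 Lemma 2: `comp_eq_conjugate_of_trace_mul_nonneg`
import Mathlib.RingTheory.SimpleRing.Field
import Mathlib.NumberTheory.NumberField.InfinitePlace.Embeddings
import Mathlib.FieldTheory.IsAlgClosed.Basic
import Mathlib.Algebra.CharP.Algebra
import Mathlib.Algebra.Module.LinearMap.Rat
import HarnessLib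

/-!
# [Kottwitz1992, §5 p. 391] «The existence of `h : ℂ → C_ℝ` forces `m` to be even» — DISCHARGED: `Kottwitz1992_5_m_even_holds`

Kernel-lane companion of the statement carpet ★ `Literature/NumberTheory/Kottwitz1992/ModuliProblem.lean` (squad TK; precedent ★
`ModuliProblemHolds`): the named fact ★ `ModuliProblem.Kottwitz1992_5_m_even` — for `C` a finite-dimensional simple `ℚ`-algebra with an
involution `*` that is trivial on the centre `F` and positive there (`tr(x x*) > 0` for central `x ≠ 0`), if `C_ℝ = ℝ ⊗_ℚ C` receives an
`ℝ`-algebra map from `ℂ` then `dim_ℚ C = (2n)² · [F : ℚ]` for some `n` (i.e. `m = (dim_F C)^{1/2}` is even) — is PROVED here as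
`theorem Kottwitz1992_5_m_even_holds : Kottwitz1992_5_m_even`.  THEOREMS ONLY (no definition, no named fact, no `sorry`, no instance, no
notation); cell hodgecm-mathlib, seat B-typ04 (g30); net debt −1.

R. E. Kottwitz, *Points on some Shimura varieties over finite fields*, J. Amer. Math. Soc. 5 (1992), §5 p. 391 L31–L34 (held
`paper:doi-10-2307-2152772`, p0019).  THE PRINT: «We need to assume that there exists an `ℝ`-algebra homomorphism `h : ℂ → C_ℝ` […]. The
existence of `h : ℂ → C_ℝ` forces `m` to be even» (`m = [F : F₀](dim_F C)^{1/2}`; the typed letter is the first-kind case `F = F₀`).  No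
proof is printed; THE PROOF GIVEN HERE (standard): §1 the centre `F = Z(C)` of the simple ring `C` is a field (Mathlib
`IsSimpleRing.isField_center`) over which `C` is central simple of finite degree, so `dim_F C = d²` (the tree's ★
`Literature.RingTheory.CentralSimple.isSquare_finrank_of_isCentral`) and `dim_ℚ C = [F : ℚ] d²`; §2 the positivity hypothesis reads
`d² · tr_{F/ℚ}(x²) > 0` (transitivity of the trace), so the identity of the number field `F` has a non-negative trace form and `F` is
totally real — the tree's ★ Shimura §5.1 Lemma 2 `Literature.NumberTheory.NumberFields.comp_eq_conjugate_of_trace_mul_nonneg` with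
`ρ = id` makes every complex embedding real; fix a real embedding `σ : F → ℝ`; §3 the image `J` of `i` under
`ℂ → ℝ ⊗_ℚ C → ℝ ⊗_{F,σ} C` (Mathlib `Algebra.TensorProduct.mapOfCompatibleSMul`) satisfies `J² = −1` in the `ℝ`-algebra `ℝ ⊗_{F,σ} C`
of real dimension `dim_F C = d²`, so `det(L_J)² = det(L_{−1}) = (−1)^{d²}` and `d` is even, `d = 2n`.  (Lean note: on the field `F` the
subalgebra `ℚ`-structure and Mathlib's canonical `DivisionRing.toRatAlgebra` coincide — `algebra_rat_subsingleton`; §1 runs on the former,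
§2 names the latter where the number-field library is invoked.)
HONEST LABEL: HC_CM is proved only modulo the 7 printed citations (2 remaining: hLiu418, h413) until rung 0 closes; this file adds no citation
debt (0 facts, 0 sorry) and discharges 1 named fact of ★ `ModuliProblem`.

## References
* [Kottwitz1992] R. E. Kottwitz, Points on some Shimura varieties over finite fields, J. Amer. Math. Soc. 5 (1992) 373–444, §5 p. 391.
* [Shimura1998] G. Shimura, Abelian Varieties with Complex Multiplication and Modular Functions, §5.1 Lemma 2 (the tree's
  `NumberFields/PositiveInvolution`).
-/

noncomputable section

namespace Literature.NumberTheory.Kottwitz1992.ModuliProblem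

open scoped TensorProduct
open Module

universe u

/-- An element `J` with `J² = −1` in a finite-dimensional real algebra `D` forces `dim_ℝ D` to be even: `det(L_J)² = det(L_{−1}) =
(−1)^{dim D}`. [folklore] -/
private theorem even_finrank_of_mul_self_eq_neg_one {D : Type*} [Ring D] [Algebra ℝ D] {J : D} (hJ : J * J = -1) :
    Even (finrank ℝ D) := by
  rcases Nat.even_or_odd (finrank ℝ D) with h | h
  · exact h
  · exfalso
    have h1 : LinearMap.mulLeft ℝ (-1 : D) = (-1 : ℝ) • (LinearMap.id : D →ₗ[ℝ] D) :=
      LinearMap.ext fun x => by rw [LinearMap.mulLeft_apply, neg_one_mul, LinearMap.smul_apply, LinearMap.id_apply, neg_one_smul]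
    have h2 : LinearMap.det (LinearMap.mulLeft ℝ J) * LinearMap.det (LinearMap.mulLeft ℝ J) = -1 := by
      rw [← map_mul, Module.End.mul_eq_comp, ← LinearMap.mulLeft_mul, hJ, h1, LinearMap.det_smul, LinearMap.det_id, mul_one,
        h.neg_one_pow]
    nlinarith [mul_self_nonneg (LinearMap.det (LinearMap.mulLeft ℝ J))]

/-- **§5 «the existence of `h : ℂ → C_ℝ` forces `m` to be even», PROVED**: ★ `Kottwitz1992_5_m_even` holds — `dim_ℚ C = (2n)² [F : ℚ]`
(see the module docstring for the proof: `[C : F] = d²`, `F` totally real by positivity, and `J² = −1` in `ℝ ⊗_{F,σ} C` of real dimension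
`d²`). [cite: Kottwitz1992, §5 (p. 391)] -/
theorem Kottwitz1992_5_m_even_holds : Kottwitz1992_5_m_even.{u} := by
  intro C _ _ _ _ _ _ hstar hpos hψ
  obtain ⟨ψ⟩ := hψ
  /- §1 the centre `F = Z(C)` is a field and `C` is central simple of finite degree `d²` over it (the `ℚ`-structure of `F` is the
  subalgebra one throughout §1: no `CharZero F` instance is in scope yet, so Mathlib's `DivisionRing.toRatAlgebra` does not fire; it is
  brought in, by name, in §2 where the number-field library is invoked) -/
  set Z : Subalgebra ℚ C := Subalgebra.center ℚ C with hZdef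
  have hZ : IsField Z :=
    MulEquiv.isField (IsSimpleRing.isField_center C)
      ({ toFun := fun x => ⟨x.1, Subring.mem_center_iff.2 (Subalgebra.mem_center_iff.1 x.2)⟩
         invFun := fun x => ⟨x.1, Subalgebra.mem_center_iff.2 (Subring.mem_center_iff.1 x.2)⟩
         left_inv := fun _ => rfl
         right_inv := fun _ => rfl
         map_mul' := fun _ _ => rfl } : Z ≃* Subring.center C)
  letI : Field Z := hZ.toField
  letI : Algebra Z C := Algebra.ofModule
    (fun c x y => by rw [Subalgebra.smul_def, Subalgebra.smul_def, smul_eq_mul, smul_eq_mul, mul_assoc])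
    (fun c x y => by
      rw [Subalgebra.smul_def, Subalgebra.smul_def, smul_eq_mul, smul_eq_mul, ← mul_assoc, Subalgebra.mem_center_iff.1 c.2 x,
        mul_assoc])
  have halg : ∀ c : Z, algebraMap Z C c = (c : C) := fun c => by
    rw [Algebra.algebraMap_eq_smul_one, Subalgebra.smul_def, smul_eq_mul, mul_one]
  haveI : IsScalarTower ℚ Z C := ⟨fun r c a => by
    rw [Subalgebra.smul_def, Subalgebra.smul_def, Subalgebra.coe_smul, smul_eq_mul, smul_eq_mul, smul_mul_assoc]⟩
  haveI : Module.Finite Z C := Module.Finite.of_restrictScalars_finite ℚ Z C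
  haveI : Algebra.IsCentral Z C := ⟨fun z hz => by
    rw [Subalgebra.mem_center_iff] at hz
    exact Algebra.mem_bot.2 ⟨⟨z, Subalgebra.mem_center_iff.2 hz⟩, halg _⟩⟩
  haveI : FiniteDimensional ℚ Z := Module.Finite.of_injective Z.val.toLinearMap Subtype.val_injective
  obtain ⟨d, hd⟩ := Literature.RingTheory.CentralSimple.isSquare_finrank_of_isCentral Z C
  have hdpos : 0 < finrank Z C := finrank_pos
  have htower : finrank ℚ C = finrank ℚ Z * finrank Z C := (Module.finrank_mul_finrank ℚ Z C).symm
  -- `tr_{C/ℚ}(L_w) = [C : F] · tr_{F/ℚ}(w)` for central `w` (a `ℚ`-basis of `F` times an `F`-basis of `C`: block-diagonal matrix)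
  have htrC : ∀ w : Z, LinearMap.trace ℚ C (LinearMap.mulLeft ℚ (algebraMap Z C w)) = (finrank Z C : ℚ) * Algebra.trace ℚ Z w := by
    intro w
    classical
    let b := Module.finBasis ℚ Z
    let c := Module.finBasis Z C
    have hl : LinearMap.mulLeft ℚ (algebraMap Z C w) = Algebra.lmul ℚ C (algebraMap Z C w) := LinearMap.ext fun _ => rfl
    rw [LinearMap.trace_eq_matrix_trace ℚ (b.smulTower c), hl, ← Algebra.leftMulMatrix_apply,
      Algebra.smulTower_leftMulMatrix_algebraMap, Matrix.trace_blockDiagonal, Finset.sum_const, Finset.card_univ, Fintype.card_fin,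
      ← Algebra.trace_eq_matrix_trace b w, nsmul_eq_mul]
  -- hence `tr_{F/ℚ}(x²) ≥ 0`: the identity of `F` has a non-negative trace form
  have htr₀ : ∀ x : Z, 0 ≤ Algebra.trace ℚ Z (x * x) := by
    intro x
    by_cases hx : x = 0
    · rw [hx, mul_zero, map_zero]
    · have hx' : (x : C) ≠ 0 := fun h => hx (Subtype.ext h)
      have h1 := hpos (x : C) x.2 hx'
      rw [hstar (x : C) x.2, ← halg, ← map_mul, htrC] at h1
      exact le_of_lt ((mul_pos_iff_of_pos_left (by exact_mod_cast hdpos)).mp h1)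
  -- the same for ANY `ℚ`-algebra structure on `F` (they all coincide: `algebra_rat_subsingleton`)
  have hgen : ∀ (inst : Algebra ℚ Z) (x : Z), 0 ≤ @Algebra.trace ℚ Z _ _ inst (x * x) := by
    intro inst x
    rw [Subsingleton.elim inst (Subalgebra.algebra Z)]
    exact htr₀ x
  -- rational scalars of the field `F`, read in `C`
  have hcastC : ∀ q : ℚ, ((q : Z) : C) = algebraMap ℚ C q := fun q => by
    rw [← eq_ratCast (algebraMap ℚ Z) q, Subalgebra.coe_algebraMap]
  /- §2 `F` is a totally real number field: a real embedding `σ` (from here on the `ℚ`-structure of the field `F` is Mathlib's canonical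
  `DivisionRing.toRatAlgebra`, the one the number-field library speaks; the two `ℚ`-algebra structures coincide, `algebra_rat_subsingleton`) -/
  haveI hcz : CharZero Z := algebraRat.charZero Z
  letI instQ : Algebra ℚ Z := DivisionRing.toRatAlgebra
  letI instQM : Module ℚ Z := Algebra.toModule
  haveI : NumberField Z := @NumberField.mk Z _ hcz
    (Module.Finite.of_injective (AddSubmonoidClass.subtype Z).toRatLinearMap Subtype.val_injective)
  have htr : ∀ x : Z, 0 ≤ Algebra.trace ℚ Z (x * RingHom.id Z x) := fun x => by
    rw [RingHom.id_apply]
    exact hgen instQ x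
  let φ : Z →+* ℂ := (IsAlgClosed.lift : Z →ₐ[ℚ] ℂ).toRingHom
  have hφ : NumberField.ComplexEmbedding.IsReal φ := by
    rw [NumberField.ComplexEmbedding.isReal_iff]
    have h := Literature.NumberTheory.NumberFields.comp_eq_conjugate_of_trace_mul_nonneg (RingHom.id Z) htr φ
    rw [RingHom.comp_id] at h
    exact h.symm
  let σ : Z →+* ℝ := hφ.embedding
  /- §3 base change along `σ`: `J² = −1` in `D = ℝ ⊗_{F,σ} C`, of real dimension `d²` -/
  letI : Algebra Z ℝ := σ.toAlgebra
  have hσ : ∀ z : Z, ∀ r : ℝ, z • r = σ z * r := fun z r => rfl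
  haveI : TensorProduct.CompatibleSMul Z ℚ ℝ C := ⟨fun q r c => by
    have h1 : q • r = (q : Z) • r := by rw [hσ, map_ratCast, Rat.smul_def]
    have h2 : q • c = (q : Z) • c := by rw [Subalgebra.smul_def, smul_eq_mul, hcastC, Algebra.smul_def]
    rw [h1, h2, TensorProduct.smul_tmul]⟩
  let θ : ℝ ⊗[ℚ] C →ₐ[ℚ] ℝ ⊗[Z] C := Algebra.TensorProduct.mapOfCompatibleSMul Z ℚ ℚ ℝ C
  have hJ : θ (ψ Complex.I) * θ (ψ Complex.I) = -1 := by
    rw [← map_mul, ← map_mul, Complex.I_mul_I, map_neg, map_one, map_neg, map_one]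
  have heven : Even (finrank ℝ (ℝ ⊗[Z] C)) := even_finrank_of_mul_self_eq_neg_one hJ
  rw [Module.finrank_baseChange, hd] at heven
  -- `d² even ⇒ d even`
  obtain ⟨n, hn⟩ : Even d := (Nat.even_mul.mp heven).elim id id
  refine ⟨n, ?_⟩
  rw [htower, hd, hn]
  ring

end Literature.NumberTheory.Kottwitz1992.ModuliProblem

end
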